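import Summits.AtomisticToContinuum.Crystallization.Theorems.LoopTunnelDialSurfaceCalibrator

/-!
# LoopTunnelDial — the SURFACE CALIBRATOR, part 2 (§4, §6): the μ-seat / floor on rich voids, the dichotomy of record, and the witnesses
# (decomp-a2c lens-5 generation 25; crux `PocketCase`, stmt-AtomisticToContinuum-27294; `--supports stmt-AtomisticToContinuum-27294 --as helper`)

Second half of kit 13 `LoopTunnelDialSurfaceCalibrator.lean`, split for the 400-line landing lint; §1–§3 (the hypothesis `H_surf`, its disclosure,
the calibrator from certified tails) are the tree module `LoopTunnelDialSurfaceCalibrator`.  §4: no RICH void at a μ-rigid configuration with a host-like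
vertex patch (`fillGain_lt_of_muStable_patch`, `rigid_richVoid_seat`, `improvable_of_richVoid_patch`, `surfaceFrustrated_or_noRichVoid`); §6: the class
`H_surf` is inhabited (dimer, fcc corner).  All `[folklore]`-level bookkeeping over kit 12; imports only landed modules; 0 sorry.
-/

open scoped BigOperators Classical Topology
open Filter
open Literature.MathematicalPhysics.StatisticalMechanics
open Summit.AtomisticToContinuum.Crystallization.Theorems.GrainPercolationDialCrossCeiling (E3)
open Summit.AtomisticToContinuum.Crystallization.Theorems.LoopTunnelDialLocalSurgery
open Summit.AtomisticToContinuum.Crystallization.Theorems.LoopTunnelDialVoidRung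
open Summit.AtomisticToContinuum.Crystallization.Theorems.LoopTunnelDialRangeTails
open Summit.AtomisticToContinuum.Crystallization.Theorems.LoopTunnelDialShellTail
open Summit.AtomisticToContinuum.Crystallization.Theorems.LoopTunnelDialCalibratorRung

namespace Summit.AtomisticToContinuum.Crystallization.Theorems.LoopTunnelDialSurfaceCalibrator

variable {N : ℕ}

/-! ## §4 Closure: no RICH void at a μ-rigid configuration with a host-like vertex patch -/

/-- **NO RICH VOID (PROVED, GS-free, every level):** at an injective `7/10`-separated configuration that is `(e, 1/(j+1), j)`-μ-stable
with `100 ≤ j` and carries a host-like vertex patch `(ρ, Θ)`, under `SurfaceCalibrator ρ Θ E` every injective hole family `q` off the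
particles with `1 ≤ k ≤ j` has fill gain `< k·(Θ + E + 1/100) + 1/50`. -/
theorem fillGain_lt_of_muStable_patch {ρ Θ E : ℝ} (hcal : SurfaceCalibrator ρ Θ E) {e : ℝ} {j : ℕ} (hj : 100 ≤ j)
    {y : Fin N → E3} (hy : Function.Injective y) (hsep : ∀ i j : Fin N, i ≠ j → (7 : ℝ) / 10 ≤ dist (y i) (y j))
    (hM : ∀ M : ℕ, N ≤ M + j → M ≤ N + j → ∀ z : Fin M → E3, Function.Injective z →
      interactionEnergy lennardJones y + e * ((M : ℝ) - N) - 1 / ((j : ℝ) + 1) ≤ interactionEnergy lennardJones z)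
    (hpatch : ∃ m : Fin N, HostLikeVertexPatch ρ Θ y m)
    {k : ℕ} (hk : 1 ≤ k) (hkj : k ≤ j) {q : Fin k → E3} (hq : Function.Injective q)
    (hdisj : ∀ (i : Fin k) (m : Fin N), q i ≠ y m) :
    -(interactionEnergy lennardJones q + ∑ i : Fin k, ∑ l : Fin N, lennardJones (dist (q i) (y l))) <
      k * (Θ + E + 1 / 100) + 1 / 50 := by
  obtain ⟨m, hm⟩ := hcal N y hy hsep hpatch
  have h := fillGain_lt_of_muStable hj hy hM hk hkj hq hdisj m
  have hk' : (0 : ℝ) ≤ k := by positivity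
  have hmono : (k : ℝ) * (1 / 100 - siteEnergy lennardJones y m) ≤ k * (Θ + E + 1 / 100) :=
    mul_le_mul_of_nonneg_left (by linarith) hk'
  linarith

/-- **μ-SEAT OF THE SURFACE CALIBRATOR (PROVED, GS-free) — the line's `RigidNearPocket0` on the class «rich void next to a host-like vertex
patch», at EVERY test radius, EVERY index and EVERY level:** along a sequence of injective `7/10`-separated configurations, for every `R ≥ 1`
and every `e`, at the order `j₀ = max ⌈64R³⌉ 100`, an `(e, 1/(j₀+1), j₀)`-μ-stable `x N` with a host-like vertex patch `(ρ, Θ)` carries NO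
`(Θ + E)`-rich void within `R` of any particle. -/
theorem rigid_richVoid_seat {ρ Θ E : ℝ} (hcal : SurfaceCalibrator ρ Θ E) (x : (N : ℕ) → (Fin N → E3))
    (hx : ∀ N, Function.Injective (x N)) (hxsep : ∀ (N : ℕ) (i j : Fin N), i ≠ j → (7 : ℝ) / 10 ≤ dist (x N i) (x N j)) :
    ∀ R : ℝ, 1 ≤ R → ∀ e : ℝ, ∃ j₀ : ℕ, ∀ N : ℕ,
      (∀ M : ℕ, N ≤ M + j₀ → M ≤ N + j₀ → ∀ z : Fin M → E3, Function.Injective z →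
        interactionEnergy lennardJones (x N) + e * ((M : ℝ) - N) - 1 / ((j₀ : ℝ) + 1) ≤ interactionEnergy lennardJones z) →
      (∃ m : Fin N, HostLikeVertexPatch ρ Θ (x N) m) →
      ¬ ∃ (c : Fin N) (k : ℕ) (q : Fin k → E3), 1 ≤ k ∧ (∀ i : Fin k, dist (q i) (x N c) ≤ R) ∧
          (∀ (i : Fin k) (l : Fin N), 9 / 10 ≤ dist (q i) (x N l)) ∧ (∀ i l : Fin k, i ≠ l → 9 / 10 ≤ dist (q i) (q l)) ∧
          (k : ℝ) * (Θ + E + 1 / 100) + 1 / 50 ≤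
            -(interactionEnergy lennardJones q + ∑ i : Fin k, ∑ l : Fin N, lennardJones (dist (q i) (x N l))) := by
  intro R hR e
  refine ⟨max ⌈64 * R ^ 3⌉₊ 100, fun N hM hpatch => ?_⟩
  rintro ⟨c, k, q, hk, hqc, hclear, hsep, hrich⟩
  have hqinj : Function.Injective q := by
    intro i l h
    by_contra hil
    have h' := hsep i l hil
    rw [h, dist_self] at h'
    norm_num at h'
  have hdisj : ∀ (i : Fin k) (m : Fin N), q i ≠ x N m := by
    intro i m h
    have h' := hclear i m
    rw [h, dist_self] at h'
    norm_num at h'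
  have hkR := holes_card_le hR hqc hsep
  have h := fillGain_lt_of_muStable_patch hcal (le_max_right _ _) (hx N) (hxsep N) hM hpatch hk
    (le_trans hkR (le_max_left _ _)) hqinj hdisj
  linarith

/-- **A RICH VOID NEXT TO A HOST-LIKE VERTEX PATCH IS A LOCAL IMPROVEMENT (PROVED, GS-free, every level `e`):** the floor reading — under
`SurfaceCalibrator ρ Θ E`, hole points `q` (`1 ≤ k`, within `R ≥ 1` of `y c`, `9/10`-clear, pairwise `9/10` apart) with fill gain
`≥ k·(Θ + E + 1/100) + 1/50` at a configuration with a host-like vertex patch make it radius-`R` improvable by `1/100` about some particle. -/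
theorem improvable_of_richVoid_patch {ρ Θ E : ℝ} (hcal : SurfaceCalibrator ρ Θ E) {y : Fin N → E3} (hy : Function.Injective y)
    (hysep : ∀ i j : Fin N, i ≠ j → (7 : ℝ) / 10 ≤ dist (y i) (y j)) (hpatch : ∃ m : Fin N, HostLikeVertexPatch ρ Θ y m)
    {R : ℝ} (hR : 1 ≤ R) {c : Fin N} {k : ℕ} {q : Fin k → E3} (hk : 1 ≤ k)
    (hqc : ∀ i : Fin k, dist (q i) (y c) ≤ R) (hclear : ∀ (i : Fin k) (m : Fin N), 9 / 10 ≤ dist (q i) (y m))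
    (hsep : ∀ i l : Fin k, i ≠ l → 9 / 10 ≤ dist (q i) (q l))
    (hrich : k * (Θ + E + 1 / 100) + 1 / 50 ≤
      -(interactionEnergy lennardJones q + ∑ i : Fin k, ∑ l : Fin N, lennardJones (dist (q i) (y l))))
    (e : ℝ) :
    ∃ c' : Fin N, ∃ (M : ℕ) (z : Fin M → E3), Function.Injective z ∧
      (∀ m' : Fin N, R < dist (y m') (y c') → y m' ∈ Set.range z) ∧
      (∀ l : Fin M, R < dist (z l) (y c') → z l ∈ Set.range y) ∧
      N ≤ M + ⌈64 * R ^ 3⌉₊ ∧ M ≤ N + ⌈64 * R ^ 3⌉₊ ∧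
      interactionEnergy lennardJones z + 1 / 100 ≤ interactionEnergy lennardJones y + e * ((M : ℝ) - N) := by
  obtain ⟨m, hm⟩ := hcal N y hy hysep hpatch
  have hk' : (0 : ℝ) ≤ k := by positivity
  have hmono : (k : ℝ) * (1 / 100 - siteEnergy lennardJones y m) ≤ k * (Θ + E + 1 / 100) :=
    mul_le_mul_of_nonneg_left (by linarith) hk'
  exact improvable_of_calibratedVoid hy (by linarith) hk (holes_card_le hR hqc hsep) hqc hclear hsep (m := m) (by linarith) e

/-- **DICHOTOMY OF RECORD (PROVED): surface frustration OR no rich void.**  Along a sequence of injective `7/10`-separated configurations,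
for every `R ≥ 1` and every level `e`, at the order `j₀ = max ⌈64R³⌉ 100`: a μ-stable `x N` is `(ρ, Θ)`-SURFACE-FRUSTRATED, or it carries no
`(Θ + E)`-rich void within `R` of any particle — for every certified tail `FarTails ρ E F`. -/
theorem surfaceFrustrated_or_noRichVoid {ρ Θ E F : ℝ} (hFT : FarTails ρ E F) (x : (N : ℕ) → (Fin N → E3))
    (hx : ∀ N, Function.Injective (x N)) (hxsep : ∀ (N : ℕ) (i j : Fin N), i ≠ j → (7 : ℝ) / 10 ≤ dist (x N i) (x N j)) :
    ∀ R : ℝ, 1 ≤ R → ∀ e : ℝ, ∃ j₀ : ℕ, ∀ N : ℕ,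
      (∀ M : ℕ, N ≤ M + j₀ → M ≤ N + j₀ → ∀ z : Fin M → E3, Function.Injective z →
        interactionEnergy lennardJones (x N) + e * ((M : ℝ) - N) - 1 / ((j₀ : ℝ) + 1) ≤ interactionEnergy lennardJones z) →
      SurfaceFrustrated ρ Θ (x N) ∨
        ¬ ∃ (c : Fin N) (k : ℕ) (q : Fin k → E3), 1 ≤ k ∧ (∀ i : Fin k, dist (q i) (x N c) ≤ R) ∧
            (∀ (i : Fin k) (l : Fin N), 9 / 10 ≤ dist (q i) (x N l)) ∧ (∀ i l : Fin k, i ≠ l → 9 / 10 ≤ dist (q i) (q l)) ∧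
            (k : ℝ) * (Θ + E + 1 / 100) + 1 / 50 ≤
              -(interactionEnergy lennardJones q + ∑ i : Fin k, ∑ l : Fin N, lennardJones (dist (q i) (x N l))) := by
  intro R hR e
  obtain ⟨j₀, hj₀⟩ := rigid_richVoid_seat (surfaceCalibrator_of_farTails (Θ := Θ) hFT) x hx hxsep R hR e
  refine ⟨j₀, fun N hM => ?_⟩
  by_cases hpatch : ∃ m : Fin N, HostLikeVertexPatch ρ Θ (x N) m
  · exact Or.inr (hj₀ N hM hpatch)
  · left
    intro m hm
    exact hpatch ⟨m, hm⟩

/-! ## §6 Witnesses: the class `H_surf` is inhabited -/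

/-- The unit vector `e₀`. -/
noncomputable def ax : E3 := EuclideanSpace.single 0 1

/-- The axis vector `ax` has unit norm (witness bookkeeping, §6). -/
theorem norm_ax : ‖ax‖ = 1 := by simp [ax]

/-- The toy dimer `(0, e₀)`. -/
noncomputable def dimer : Fin 2 → E3 := ![0, ax]

/-- The dimer's first particle sits at the origin (witness bookkeeping, §6). -/
theorem dimer_zero : dimer 0 = 0 := rfl
/-- The dimer's second particle sits at `ax` (witness bookkeeping, §6). -/
theorem dimer_one : dimer 1 = ax := rfl

/-- The dimer configuration is injective (witness bookkeeping, §6). -/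
theorem dimer_injective : Function.Injective dimer := by
  have h01 : dimer 0 ≠ dimer 1 := fun h => by
    have h' : ‖dimer 1‖ = 1 := by rw [dimer_one, norm_ax]
    rw [← h, dimer_zero, norm_zero] at h'
    norm_num at h'
  intro a b h
  fin_cases a <;> fin_cases b
  · rfl
  · exact absurd (by simpa using h) h01
  · exact absurd (by simpa using h.symm) h01
  · rfl

/-- **(W1) the dimer's end is a host-like vertex patch, `Θ = 1/12`:** `HostLikeVertexPatch 2 (1/12) dimer 0`. -/
theorem hostLikeVertexPatch_dimer : HostLikeVertexPatch 2 (1 / 12) dimer 0 := by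
  have hcard : (nearIdx 2 dimer 0).card ≤ 1 := by
    calc (nearIdx 2 dimer 0).card ≤ (Finset.univ.erase (0 : Fin 2)).card := Finset.card_filter_le _ _
      _ = 1 := by rw [Finset.card_erase_of_mem (Finset.mem_univ _)]; simp
  have hanti : ∀ l l' : Fin 2, l ≠ 0 → l' ≠ 0 → dist (dimer 0) (dimer l) ≤ 2 → dist (dimer 0) (dimer l') ≤ 2 →
      dimer l - dimer 0 ≠ -(dimer l' - dimer 0) := by
    intro l l' hl hl' _ _ h
    fin_cases l
    · exact hl rfl
    fin_cases l'
    · exact hl' rfl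
    have h1 : ax = -ax := by simpa [dimer_zero, dimer_one] using h
    have h2 := congrArg (fun v : E3 => v 0) h1
    simp [ax] at h2
    norm_num at h2
  have hclear : ∀ l : Fin 2, l ≠ 0 → dist (dimer 0) (dimer l) ≤ 2 → 9 / 10 ≤ dist (dimer 0) (dimer l) := by
    intro l hl _
    fin_cases l
    · exact absurd rfl hl
    · simp [dimer_zero, dimer_one, norm_ax]
      norm_num
  have h := hostLikeVertexPatch_of_vertex dimer_injective 0 hanti hclear
  -- level `card/12 ≤ 1/12`
  rw [hostLikeVertexPatch_iff dimer_injective] at h ⊢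
  refine ⟨h.1, h.2.1, ?_⟩
  have hc : ((nearIdx 2 dimer 0).card : ℝ) ≤ 1 := by exact_mod_cast hcard
  have h3 := h.2.2
  have : -(1 / 12 : ℝ) ≤ -(((nearIdx 2 dimer 0).card : ℝ) / 12) := by linarith
  linarith

/-- The three `(1,1,0)`-family vectors of an fcc corner (spacing `√2`). -/
noncomputable def u01 : E3 := EuclideanSpace.single 0 1 + EuclideanSpace.single 1 1
/-- see `u01` -/
noncomputable def u02 : E3 := EuclideanSpace.single 0 1 + EuclideanSpace.single 2 1
/-- see `u01` -/
noncomputable def u12 : E3 := EuclideanSpace.single 1 1 + EuclideanSpace.single 2 1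

/-- The fcc CORNER patch: a site with three mutually adjacent neighbours `(1,1,0), (1,0,1), (0,1,1)`. -/
noncomputable def fccCorner : Fin 4 → E3 := ![0, u01, u02, u12]

/-- `‖u01‖² = 2` (witness bookkeeping, §6). -/
theorem norm_sq_u01 : ‖u01‖ ^ 2 = 2 := by
  rw [EuclideanSpace.norm_sq_eq, Fin.sum_univ_three]
  simp [u01]
  norm_num
/-- `‖u02‖² = 2` (witness bookkeeping, §6). -/
theorem norm_sq_u02 : ‖u02‖ ^ 2 = 2 := by
  rw [EuclideanSpace.norm_sq_eq, Fin.sum_univ_three]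
  simp [u02]
  norm_num
/-- `‖u12‖² = 2` (witness bookkeeping, §6). -/
theorem norm_sq_u12 : ‖u12‖ ^ 2 = 2 := by
  rw [EuclideanSpace.norm_sq_eq, Fin.sum_univ_three]
  simp [u12]
  norm_num

/-- The corner vectors are pairwise non-antipodal (and non-self-antipodal). -/
theorem corner_ne_neg (a b : E3) (ha : a = u01 ∨ a = u02 ∨ a = u12) (hb : b = u01 ∨ b = u02 ∨ b = u12) : a ≠ -b := by
  intro h
  have h0 := congrArg (fun v : E3 => v 0) h
  have h2 := congrArg (fun v : E3 => v 2) h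
  rcases ha with rfl | rfl | rfl <;> rcases hb with rfl | rfl | rfl <;>
    simp [u01, u02, u12] at h0 h2 <;> linarith

/-- The three non-central corner particles are `u01`, `u02`, `u12` (witness bookkeeping, §6). -/
theorem fccCorner_succ_mem (l : Fin 4) (hl : l ≠ 0) : fccCorner l = u01 ∨ fccCorner l = u02 ∨ fccCorner l = u12 := by
  fin_cases l
  · exact absurd rfl hl
  · exact Or.inl rfl
  · exact Or.inr (Or.inl rfl)
  · exact Or.inr (Or.inr rfl)

/-- Every non-central corner particle is at distance `≥ 9/10` from the centre (witness bookkeeping, §6). -/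
theorem norm_fccCorner_ge (l : Fin 4) (hl : l ≠ 0) : 9 / 10 ≤ ‖fccCorner l‖ := by
  have hsq : ‖fccCorner l‖ ^ 2 = 2 := by
    rcases fccCorner_succ_mem l hl with h | h | h <;> rw [h]
    exacts [norm_sq_u01, norm_sq_u02, norm_sq_u12]
  nlinarith [norm_nonneg (fccCorner l)]

/-- `u01 ≠ u02` (witness bookkeeping, §6). -/
theorem u01_ne_u02 : u01 ≠ u02 := fun h => by
  have h1 := congrArg (fun v : E3 => v 1) h
  simp [u01, u02] at h1
/-- `u01 ≠ u12` (witness bookkeeping, §6). -/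
theorem u01_ne_u12 : u01 ≠ u12 := fun h => by
  have h0 := congrArg (fun v : E3 => v 0) h
  simp [u01, u12] at h0
/-- `u02 ≠ u12` (witness bookkeeping, §6). -/
theorem u02_ne_u12 : u02 ≠ u12 := fun h => by
  have h0 := congrArg (fun v : E3 => v 0) h
  simp [u02, u12] at h0
/-- `0 ≠ u01` (witness bookkeeping, §6). -/
theorem zero_ne_u01 : (0 : E3) ≠ u01 := fun h => by
  have h0 := congrArg (fun v : E3 => v 0) h
  simp [u01] at h0
/-- `0 ≠ u02` (witness bookkeeping, §6). -/
theorem zero_ne_u02 : (0 : E3) ≠ u02 := fun h => by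
  have h0 := congrArg (fun v : E3 => v 0) h
  simp [u02] at h0
/-- `0 ≠ u12` (witness bookkeeping, §6). -/
theorem zero_ne_u12 : (0 : E3) ≠ u12 := fun h => by
  have h1 := congrArg (fun v : E3 => v 1) h
  simp [u12] at h1

/-- The fcc corner configuration is injective (witness bookkeeping, §6). -/
theorem fccCorner_injective : Function.Injective fccCorner := by
  rw [← List.nodup_ofFn]
  have h : List.ofFn fccCorner = [0, u01, u02, u12] := rfl
  rw [h]
  simp [zero_ne_u01, zero_ne_u02, zero_ne_u12, u01_ne_u02, u01_ne_u12, u02_ne_u12]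

/-- **(W2) the fcc corner is a host-like vertex patch, `Θ = 1/4`:** `HostLikeVertexPatch 2 (1/4) fccCorner 0` (crude level `3/12` from
`V_LJ ≥ −1/12`; the exact half-binding of the six-vector star `{±(1,1,0), ±(1,0,1), ±(0,1,1)}` is `15/256`). -/
theorem hostLikeVertexPatch_fccCorner : HostLikeVertexPatch 2 (1 / 4) fccCorner 0 := by
  have hcard : (nearIdx 2 fccCorner 0).card ≤ 3 := by
    calc (nearIdx 2 fccCorner 0).card ≤ (Finset.univ.erase (0 : Fin 4)).card := Finset.card_filter_le _ _
      _ = 3 := by rw [Finset.card_erase_of_mem (Finset.mem_univ _)]; simp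
  have hanti : ∀ l l' : Fin 4, l ≠ 0 → l' ≠ 0 → dist (fccCorner 0) (fccCorner l) ≤ 2 → dist (fccCorner 0) (fccCorner l') ≤ 2 →
      fccCorner l - fccCorner 0 ≠ -(fccCorner l' - fccCorner 0) := by
    intro l l' hl hl' _ _
    have h0 : fccCorner 0 = 0 := rfl
    rw [h0, sub_zero, sub_zero]
    exact corner_ne_neg _ _ (fccCorner_succ_mem l hl) (fccCorner_succ_mem l' hl')
  have hclear : ∀ l : Fin 4, l ≠ 0 → dist (fccCorner 0) (fccCorner l) ≤ 2 → 9 / 10 ≤ dist (fccCorner 0) (fccCorner l) := by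
    intro l hl _
    have h0 : fccCorner 0 = 0 := rfl
    rw [h0, dist_eq_norm, zero_sub, norm_neg]
    exact norm_fccCorner_ge l hl
  have h := hostLikeVertexPatch_of_vertex fccCorner_injective 0 hanti hclear
  rw [hostLikeVertexPatch_iff fccCorner_injective] at h ⊢
  refine ⟨h.1, h.2.1, ?_⟩
  have hc : ((nearIdx 2 fccCorner 0).card : ℝ) ≤ 3 := by exact_mod_cast hcard
  have h3 := h.2.2
  have : -(1 / 4 : ℝ) ≤ -(((nearIdx 2 fccCorner 0).card : ℝ) / 12) := by linarith
  linarith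

/-- **The class is inhabited:** a configuration with a host-like vertex patch exists (so the calibrator, the seat and the floor are not
statements about the empty class). -/
theorem hostLikeVertexPatch_nonempty :
    ∃ (N : ℕ) (y : Fin N → E3) (m : Fin N), Function.Injective y ∧ HostLikeVertexPatch 2 (1 / 4) y m :=
  ⟨4, fccCorner, 0, fccCorner_injective, hostLikeVertexPatch_fccCorner⟩

end Summit.AtomisticToContinuum.Crystallization.Theorems.LoopTunnelDialSurfaceCalibrator
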